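import Summits.NavierStokesRegularity.NavierStokesRegularity.Theorems.ScaledTopAlignmentNearMaxLawGoodRatePoints
import Summits.NavierStokesRegularity.NavierStokesRegularity.Theorems.ScaledTopAlignmentAprioriMostTimesBulkAlignmentNearMaxOfSomeAlignedWindowLaw
import Summits.NavierStokesRegularity.NavierStokesRegularity.Theorems.ScaledTopAlignmentAprioriMostTimesBulkAlignmentNearMaxOfUniversalLaws
import Summits.NavierStokesRegularity.NavierStokesRegularity.Theorems.TypeILiouvilleTypeIliouvilleNoTypeIIDoorCalculus
import HarnessLib

/-!
# Route `ScaledTopAlignment`, crux W3ᵐᵗ = `AprioriMostTimesBulkAlignment` (stmt-NavierStokesRegularity-19551),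
# registered line `nearmax` (open stub `stub_nearMaxMostTimes`): the WEAKEST killable BUDGET-currency law —
# ONE δ-good near-max window per good time suffices

Budget-currency twin of `ScaledTopAlignmentAprioriMostTimesBulkAlignmentNearMaxOfSomeAlignedWindowLaw`. The planner's
law UDW∞ (ROUND-10, mass-fraction form) was glued to `ThreadingFlux.Target` in
`ScaledTopAlignmentAprioriMostTimesBulkAlignmentNearMaxOfCoherenceLaw`. Since the budget portrait holds at EVERY late rate
point (`typeI_uniform_window_budget_decoherence`, `ScaledTopAlignmentTypeIBlowupBudgetPortrait`), the following much
weaker per-time EXISTENCE law already excludes Type-I blow-up — UDW∃: universal `λ₀ < 1`, `R₀ > 0`, `θ < 1`; per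
`(q, δ)` a universal gate `A`; in every classical Leray–Hopf flow from rapidly decaying data with `‖curl u₀‖ ≤ m₀`,
outside exceptional times of final density `≤ θ`, at every time carrying an `A·m₀`-amplified `q`-near-maximal point
SOME such point has a `δ`-GOOD window `∫_S|ω|^{3/2}‖∇ξ‖² ≤ δ·∫_S|ω|^{5/2}/ν`:

* `false_of_someGoodRateWindows_typeI` — per solution: the Type-I rate and δ-good rate windows arbitrarily late, for
  the portrait's `δ`, are incompatible;
* `threadingFluxTarget_of_universalSomeGoodWindowLaw` — **UDW∃ ⇒ `ThreadingFlux.Target`** (1217);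
* `aprioriMostTimesBulkAlignment_of_universalSomeGoodWindowLaw_of_typeIIResidue` — ∧ R_II ⇒ the crux by name;
* `nearMaxMostTimesDoor_of_universalSomeGoodWindowLaw_of_typeIIResidue` — ∧ R_II ⇒ the registered STUB 1 literally;
* `navierStokesRegularity_of_universalSomeGoodWindowLaw_of_noTypeII` — ∧ NoTypeII ⇒ Clay (A).

Design consequence for the cell's instrument BUDGET-9 (stated, not used): to refute UDW∃ a certified reading must show,
on a positive final-density set of times, that the MINIMUM over amplified near-max points of the window ratio
budget/saturation stays above `δ` — not merely its mean or mass fraction. hard core evaded: none — UDW∃ IMPLIES Target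
(1217); NoTypeII (0056) is the residual. WHAT THIS IS NOT: not NS regularity, not a proof of UDW∃ or of the stub. [folklore]
-/

noncomputable section

-- the summit and its single sub-problem share the name (CONVENTIONS §1), as in every Theorems file
set_option linter.dupNamespace false

open MeasureTheory Set Function Filter Topology Metric
open scoped RealInnerProductSpace ENNReal
open Literature.Analysis Literature.Analysis.FluidPDE

namespace Summit.NavierStokesRegularity.NavierStokesRegularity.Theorems

/-! ### Per solution: δ-good rate windows arbitrarily late are incompatible with the Type-I rate -/

/-- **One δ-good late rate window per request kills Type I.** For a classical Leray–Hopf solution from a rapidly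
decaying datum with the Type-I rate at `T`, and `λ₀ < 1`, `R₀ > 0`, `κ > 0`: it is impossible that for every `δ > 0` and
every `t₁ < T` some rate point `(t, x)`, `t ∈ [t₁, T)`, `κ/(T − t) ≤ |ω(t,x)|`, has a `δ`-good window
`∫_S|ω|^{3/2}‖∇ξ‖² ≤ δ·∫_S|ω|^{5/2}/ν` — by the every-point portrait `typeI_uniform_window_budget_decoherence`. [folklore] -/
theorem false_of_someGoodRateWindows_typeI {ν T : ℝ} (hν : 0 < ν) (hT : 0 < T)
    {u : ℝ → EuclideanSpace ℝ (Fin 3) → EuclideanSpace ℝ (Fin 3)} {p : ℝ → EuclideanSpace ℝ (Fin 3) → ℝ}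
    (hsol : IsClassicalNSSolutionOn (Ico 0 T) ν 0 u p) (hLH : IsLerayHopfOn T ν 0 (u 0) u)
    (hdec : HasRapidSpatialDecay (u 0)) (hI : IsTypeIBlowup u T)
    {κ lam0 R0 : ℝ} (hκ : 0 < κ) (hlam1 : lam0 < 1) (hR0 : 0 < R0)
    (hgw : ∀ δ : ℝ, 0 < δ → ∀ t₁ ∈ Ico 0 T, ∃ t ∈ Ico t₁ T, ∃ x : EuclideanSpace ℝ (Fin 3),
      κ / (T - t) ≤ ‖curl (u t) x‖ ∧
        (∫⁻ y in {y : EuclideanSpace ℝ (Fin 3) | lam0 * ‖curl (u t) x‖ ≤ ‖curl (u t) y‖ ∧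
              ‖y - x‖ ≤ R0 * Real.sqrt (ν / ‖curl (u t) x‖)},
            ENNReal.ofReal (‖curl (u t) y‖ ^ (3 / 2 : ℝ) *
              ‖fderiv ℝ (vorticityDirection (curl (u t))) y‖ ^ 2)) ≤
          ENNReal.ofReal δ *
            ∫⁻ y in {y : EuclideanSpace ℝ (Fin 3) | lam0 * ‖curl (u t) x‖ ≤ ‖curl (u t) y‖ ∧
                ‖y - x‖ ≤ R0 * Real.sqrt (ν / ‖curl (u t) x‖)},
              ENNReal.ofReal (‖curl (u t) y‖ ^ (5 / 2 : ℝ) / ν)) : False := by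
  obtain ⟨δ, hδ, t₁, ht₁, hB⟩ := typeI_uniform_window_budget_decoherence hν hT hsol hLH hdec hI hκ hlam1 hR0
  obtain ⟨t, ht, x, hrate, hle⟩ := hgw δ hδ t₁ ht₁
  exact absurd hle (not_le.2 (hB t ht x hrate))

/-! ### The law UDW∃ and its consequences -/

/-- **UDW∃ ⇒ the hard core `ThreadingFlux.Target`.** The inline hypothesis is the weak budget law: universal `λ₀ < 1`,
`R₀ > 0`, `θ < 1`; per `(q, δ)` a universal gate `A`; in every classical Leray–Hopf flow from rapidly decaying data with
`‖curl u₀‖ ≤ m₀`, outside exceptional times of final density `≤ θ`, at every time carrying an `A·m₀`-amplified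
`q`-near-maximal point, SOME such point has a `δ`-good window. Per solution with a Type-I first blow-up: late times
outside `E` exist (`exists_late_notMem_of_finalDensity`), amplified `q`-near-maximal points exist there (`q < 1`, lower
vorticity rate), they are rate points (`κ = c/4` for `q = 1/2`), and the every-point budget portrait forbids a good window
there (`false_of_someGoodRateWindows_typeI`). [folklore] -/
theorem threadingFluxTarget_of_universalSomeGoodWindowLaw
    (hL : ∃ lam0 : ℝ, lam0 < 1 ∧ ∃ R0 : ℝ, 0 < R0 ∧ ∃ θ : ℝ, θ < 1 ∧
      ∀ q : ℝ, 0 < q → ∀ δ : ℝ, 0 < δ → ∃ A : ℝ, 0 < A ∧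
        ∀ (ν T : ℝ), 0 < ν → 0 < T → ∀ (u : ℝ → EuclideanSpace ℝ (Fin 3) → EuclideanSpace ℝ (Fin 3))
          (p : ℝ → EuclideanSpace ℝ (Fin 3) → ℝ),
          IsClassicalNSSolutionOn (Set.Ico 0 T) ν 0 u p → IsLerayHopfOn T ν 0 (u 0) u → HasRapidSpatialDecay (u 0) →
          ∀ m0 : ℝ, 0 < m0 → (∀ x, ‖curl (u 0) x‖ ≤ m0) →
            ∃ E : Set ℝ, (∃ h0 : ℝ, 0 < h0 ∧ ∀ h : ℝ, 0 < h → h < h0 →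
                volume (E ∩ Set.Ioo (T - h) T) ≤ ENNReal.ofReal (θ * h)) ∧
              ∀ t ∈ Set.Ico 0 T, t ∉ E →
                (∃ x : EuclideanSpace ℝ (Fin 3), A * m0 ≤ ‖curl (u t) x‖ ∧
                  ∀ x' : EuclideanSpace ℝ (Fin 3), q * ‖curl (u t) x'‖ ≤ ‖curl (u t) x‖) →
                ∃ x : EuclideanSpace ℝ (Fin 3), A * m0 ≤ ‖curl (u t) x‖ ∧
                  (∀ x' : EuclideanSpace ℝ (Fin 3), q * ‖curl (u t) x'‖ ≤ ‖curl (u t) x‖) ∧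
                  (∫⁻ y in {y : EuclideanSpace ℝ (Fin 3) | lam0 * ‖curl (u t) x‖ ≤ ‖curl (u t) y‖ ∧
                      ‖y - x‖ ≤ R0 * Real.sqrt (ν / ‖curl (u t) x‖)},
                    ENNReal.ofReal (‖curl (u t) y‖ ^ (3 / 2 : ℝ) *
                      ‖fderiv ℝ (vorticityDirection (curl (u t))) y‖ ^ 2)) ≤
                  ENNReal.ofReal δ *
                    ∫⁻ y in {y : EuclideanSpace ℝ (Fin 3) | lam0 * ‖curl (u t) x‖ ≤ ‖curl (u t) y‖ ∧
                        ‖y - x‖ ≤ R0 * Real.sqrt (ν / ‖curl (u t) x‖)},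
                      ENNReal.ofReal (‖curl (u t) y‖ ^ (5 / 2 : ℝ) / ν)) :
    Summit.NavierStokesRegularity.NavierStokesRegularity.Theses.ThreadingFlux.Target := by
  intro ν T hν hT u p hcl hLH hdec hI
  by_contra hext
  obtain ⟨lam0, hlam1, R0, hR0, θ, hθ, hfam⟩ := hL
  obtain ⟨m0, hm0, hbd⟩ := exists_bound_curl_of_rapidDecay hdec
  -- the two-sided vorticity rate; near-max fraction `q = 1/2`, rate floor `κ = c/4`
  obtain ⟨Cω, tω, htω, hup⟩ := TubeAlternative.AnalyticPropagation.upper_vorticity_rate hν hT hcl hLH hdec hI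
  obtain ⟨c, hc, tc, htc, hlow⟩ :=
    TubeAlternative.AnalyticPropagation.lower_vorticity_rate hν hT ⟨hcl, hext⟩ hLH hdec hI
  have hκ : 0 < (1 / 4 : ℝ) * c := by positivity
  refine false_of_someGoodRateWindows_typeI hν hT hcl hLH hdec hI hκ hlam1 hR0 fun δ hδ t₁ ht₁ => ?_
  obtain ⟨A, hA, hA'⟩ := hfam (1 / 2) (by norm_num) δ hδ
  obtain ⟨E, hE, hgood⟩ := hA' ν T hν hT u p hcl hLH hdec m0 hm0 hbd
  -- a late time outside `E`, after `t₁, tω, tc` and after the amplification threshold `c/(T−t) ≥ 2 A m₀`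
  set tstar : ℝ := max (max (max t₁ tω) tc) (T - c / (2 * (A * m0))) with htstar
  have hq0 : 0 < c / (2 * (A * m0)) := by positivity
  have htstarT : tstar < T := max_lt (max_lt (max_lt ht₁.2 htω.2) htc.2) (by linarith)
  obtain ⟨t, ht, htE⟩ := exists_late_notMem_of_finalDensity (T := T) hθ hE htstarT
  have ht₁t : t₁ ≤ t := (((le_max_left _ _).trans (le_max_left _ _)).trans (le_max_left _ _)).trans ht.1
  have htωt : t ∈ Ico tω T := ⟨(((le_max_right _ _).trans (le_max_left _ _)).trans (le_max_left _ _)).trans ht.1, ht.2⟩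
  have htct : t ∈ Ico tc T := ⟨((le_max_right _ _).trans (le_max_left _ _)).trans ht.1, ht.2⟩
  have ht0T : t ∈ Ico 0 T := ⟨ht₁.1.trans ht₁t, ht.2⟩
  have hTt : 0 < T - t := sub_pos.2 ht.2
  -- the slice supremum and an amplified `1/2`-near-maximal point
  have hbdd : BddAbove (range fun z => ‖curl (u t) z‖) :=
    ⟨Cω / (T - t), by rintro _ ⟨z, rfl⟩; exact hup t htωt z⟩
  obtain ⟨x', hx'⟩ := hlow t htct
  have hs_ge : c / (T - t) ≤ ⨆ z, ‖curl (u t) z‖ := hx'.trans (le_ciSup hbdd x')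
  have hs0 : 0 < ⨆ z, ‖curl (u t) z‖ := lt_of_lt_of_le (div_pos hc hTt) hs_ge
  have hlt : (1 / 2 : ℝ) * (⨆ z, ‖curl (u t) z‖) < ⨆ z, ‖curl (u t) z‖ := by linarith
  obtain ⟨z, hz⟩ : ∃ z, (1 / 2 : ℝ) * (⨆ z, ‖curl (u t) z‖) < ‖curl (u t) z‖ := exists_lt_of_lt_ciSup hlt
  have hznear : ∀ x'' : EuclideanSpace ℝ (Fin 3), (1 / 2 : ℝ) * ‖curl (u t) x''‖ ≤ ‖curl (u t) z‖ := fun x'' =>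
    (mul_le_mul_of_nonneg_left (le_ciSup hbdd x'') (by norm_num)).trans hz.le
  have hamp : A * m0 ≤ ‖curl (u t) z‖ := by
    -- `c/(T−t) ≥ 2 A m₀` since `T − t ≤ c/(2 A m₀)`
    have h1 : T - t ≤ c / (2 * (A * m0)) := by
      have := le_max_right (max (max t₁ tω) tc) (T - c / (2 * (A * m0))); rw [← htstar] at this; linarith [ht.1]
    have hAm0 : 0 < A * m0 := by positivity
    have h2 : 2 * (A * m0) ≤ c / (T - t) := by
      rw [le_div_iff₀ hTt]
      calc 2 * (A * m0) * (T - t) ≤ 2 * (A * m0) * (c / (2 * (A * m0))) :=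
            mul_le_mul_of_nonneg_left h1 (by positivity)
        _ = c := by field_simp
    linarith [hs_ge, hz.le]
  obtain ⟨x, hxamp, hxnear, hxle⟩ := hgood t ht0T htE ⟨z, hamp, hznear⟩
  -- the good point is a rate point with `κ = c/4`
  refine ⟨t, ⟨ht₁t, ht.2⟩, x, ?_, hxle⟩
  calc 1 / 4 * c / (T - t) = (1 / 4 : ℝ) * (c / (T - t)) := by ring
    _ ≤ (1 / 4 : ℝ) * ⨆ z, ‖curl (u t) z‖ := mul_le_mul_of_nonneg_left hs_ge (by norm_num)
    _ ≤ (1 / 2 : ℝ) * ‖curl (u t) z‖ := by linarith [hz.le]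
    _ ≤ ‖curl (u t) x‖ := by
        have := hxnear z
        linarith

/-- **UDW∃ ∧ R_II ⇒ the CRUX by name** (`aprioriMostTimesBulkAlignment_iff_target_and_typeII`). [folklore] -/
theorem aprioriMostTimesBulkAlignment_of_universalSomeGoodWindowLaw_of_typeIIResidue
    (hL : ∃ lam0 : ℝ, lam0 < 1 ∧ ∃ R0 : ℝ, 0 < R0 ∧ ∃ θ : ℝ, θ < 1 ∧
      ∀ q : ℝ, 0 < q → ∀ δ : ℝ, 0 < δ → ∃ A : ℝ, 0 < A ∧
        ∀ (ν T : ℝ), 0 < ν → 0 < T → ∀ (u : ℝ → EuclideanSpace ℝ (Fin 3) → EuclideanSpace ℝ (Fin 3))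
          (p : ℝ → EuclideanSpace ℝ (Fin 3) → ℝ),
          IsClassicalNSSolutionOn (Set.Ico 0 T) ν 0 u p → IsLerayHopfOn T ν 0 (u 0) u → HasRapidSpatialDecay (u 0) →
          ∀ m0 : ℝ, 0 < m0 → (∀ x, ‖curl (u 0) x‖ ≤ m0) →
            ∃ E : Set ℝ, (∃ h0 : ℝ, 0 < h0 ∧ ∀ h : ℝ, 0 < h → h < h0 →
                volume (E ∩ Set.Ioo (T - h) T) ≤ ENNReal.ofReal (θ * h)) ∧
              ∀ t ∈ Set.Ico 0 T, t ∉ E →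
                (∃ x : EuclideanSpace ℝ (Fin 3), A * m0 ≤ ‖curl (u t) x‖ ∧
                  ∀ x' : EuclideanSpace ℝ (Fin 3), q * ‖curl (u t) x'‖ ≤ ‖curl (u t) x‖) →
                ∃ x : EuclideanSpace ℝ (Fin 3), A * m0 ≤ ‖curl (u t) x‖ ∧
                  (∀ x' : EuclideanSpace ℝ (Fin 3), q * ‖curl (u t) x'‖ ≤ ‖curl (u t) x‖) ∧
                  (∫⁻ y in {y : EuclideanSpace ℝ (Fin 3) | lam0 * ‖curl (u t) x‖ ≤ ‖curl (u t) y‖ ∧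
                      ‖y - x‖ ≤ R0 * Real.sqrt (ν / ‖curl (u t) x‖)},
                    ENNReal.ofReal (‖curl (u t) y‖ ^ (3 / 2 : ℝ) *
                      ‖fderiv ℝ (vorticityDirection (curl (u t))) y‖ ^ 2)) ≤
                  ENNReal.ofReal δ *
                    ∫⁻ y in {y : EuclideanSpace ℝ (Fin 3) | lam0 * ‖curl (u t) x‖ ≤ ‖curl (u t) y‖ ∧
                        ‖y - x‖ ≤ R0 * Real.sqrt (ν / ‖curl (u t) x‖)},
                      ENNReal.ofReal (‖curl (u t) y‖ ^ (5 / 2 : ℝ) / ν))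
    (hRII : ∀ (ν T : ℝ), 0 < ν → 0 < T → ∀ (u : ℝ → EuclideanSpace ℝ (Fin 3) → EuclideanSpace ℝ (Fin 3))
        (p : ℝ → EuclideanSpace ℝ (Fin 3) → ℝ),
        IsClassicalNSSolutionOn (Set.Ico 0 T) ν 0 u p → IsLerayHopfOn T ν 0 (u 0) u →
        HasRapidSpatialDecay (u 0) → ¬ HasSmoothExtensionPast ν 0 u T → ¬ IsTypeIBlowup u T →
        ∃ lam0 : ℝ, lam0 < 1 ∧ ∃ R0 : ℝ, 0 < R0 ∧ ∃ θ : ℝ, θ < 1 ∧ ∀ κ : ℝ, 0 < κ → ∀ ε : ℝ, 0 < ε →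
          ∀ δ : ℝ, 0 < δ → ∃ M : ℝ, 0 < M ∧ ∃ E : Set ℝ,
            (∃ h0 : ℝ, 0 < h0 ∧ ∀ h : ℝ, 0 < h → h < h0 →
              volume (E ∩ Set.Ioo (T - h) T) ≤ ENNReal.ofReal (θ * h)) ∧
            ∀ t ∈ Set.Ico 0 T, t ∉ E → ∀ x : EuclideanSpace ℝ (Fin 3), M ≤ ‖curl (u t) x‖ →
              κ / (T - t) ≤ ‖curl (u t) x‖ →
              volume {y : EuclideanSpace ℝ (Fin 3) | lam0 * ‖curl (u t) x‖ ≤ ‖curl (u t) y‖ ∧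
                  ‖x - y‖ ≤ R0 * Real.sqrt (ν / ‖curl (u t) x‖) ∧
                  ε < Real.sqrt (1 - (inner ℝ (‖curl (u t) x‖⁻¹ • curl (u t) x)
                    (‖curl (u t) y‖⁻¹ • curl (u t) y)) ^ 2)}
                ≤ ENNReal.ofReal (δ * Real.sqrt (ν / ‖curl (u t) x‖) ^ 3)) :
    Summit.NavierStokesRegularity.NavierStokesRegularity.Theses.ScaledTopAlignment.AprioriMostTimesBulkAlignment :=
  aprioriMostTimesBulkAlignment_iff_target_and_typeII.mpr
    ⟨threadingFluxTarget_of_universalSomeGoodWindowLaw hL, hRII⟩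

/-- **UDW∃ ∧ R_II ⇒ STUB 1 of line `nearmax`, literally** (the conclusion is the signature of the registered stub
`Nearmax.stub_nearMaxMostTimes`; via `nearMaxMostTimesBulkAlignment_of_aprioriMostTimesBulkAlignment`). [folklore] -/
theorem nearMaxMostTimesDoor_of_universalSomeGoodWindowLaw_of_typeIIResidue
    (hL : ∃ lam0 : ℝ, lam0 < 1 ∧ ∃ R0 : ℝ, 0 < R0 ∧ ∃ θ : ℝ, θ < 1 ∧
      ∀ q : ℝ, 0 < q → ∀ δ : ℝ, 0 < δ → ∃ A : ℝ, 0 < A ∧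
        ∀ (ν T : ℝ), 0 < ν → 0 < T → ∀ (u : ℝ → EuclideanSpace ℝ (Fin 3) → EuclideanSpace ℝ (Fin 3))
          (p : ℝ → EuclideanSpace ℝ (Fin 3) → ℝ),
          IsClassicalNSSolutionOn (Set.Ico 0 T) ν 0 u p → IsLerayHopfOn T ν 0 (u 0) u → HasRapidSpatialDecay (u 0) →
          ∀ m0 : ℝ, 0 < m0 → (∀ x, ‖curl (u 0) x‖ ≤ m0) →
            ∃ E : Set ℝ, (∃ h0 : ℝ, 0 < h0 ∧ ∀ h : ℝ, 0 < h → h < h0 →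
                volume (E ∩ Set.Ioo (T - h) T) ≤ ENNReal.ofReal (θ * h)) ∧
              ∀ t ∈ Set.Ico 0 T, t ∉ E →
                (∃ x : EuclideanSpace ℝ (Fin 3), A * m0 ≤ ‖curl (u t) x‖ ∧
                  ∀ x' : EuclideanSpace ℝ (Fin 3), q * ‖curl (u t) x'‖ ≤ ‖curl (u t) x‖) →
                ∃ x : EuclideanSpace ℝ (Fin 3), A * m0 ≤ ‖curl (u t) x‖ ∧
                  (∀ x' : EuclideanSpace ℝ (Fin 3), q * ‖curl (u t) x'‖ ≤ ‖curl (u t) x‖) ∧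
                  (∫⁻ y in {y : EuclideanSpace ℝ (Fin 3) | lam0 * ‖curl (u t) x‖ ≤ ‖curl (u t) y‖ ∧
                      ‖y - x‖ ≤ R0 * Real.sqrt (ν / ‖curl (u t) x‖)},
                    ENNReal.ofReal (‖curl (u t) y‖ ^ (3 / 2 : ℝ) *
                      ‖fderiv ℝ (vorticityDirection (curl (u t))) y‖ ^ 2)) ≤
                  ENNReal.ofReal δ *
                    ∫⁻ y in {y : EuclideanSpace ℝ (Fin 3) | lam0 * ‖curl (u t) x‖ ≤ ‖curl (u t) y‖ ∧
                        ‖y - x‖ ≤ R0 * Real.sqrt (ν / ‖curl (u t) x‖)},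
                      ENNReal.ofReal (‖curl (u t) y‖ ^ (5 / 2 : ℝ) / ν))
    (hRII : ∀ (ν T : ℝ), 0 < ν → 0 < T → ∀ (u : ℝ → EuclideanSpace ℝ (Fin 3) → EuclideanSpace ℝ (Fin 3))
        (p : ℝ → EuclideanSpace ℝ (Fin 3) → ℝ),
        IsClassicalNSSolutionOn (Set.Ico 0 T) ν 0 u p → IsLerayHopfOn T ν 0 (u 0) u →
        HasRapidSpatialDecay (u 0) → ¬ HasSmoothExtensionPast ν 0 u T → ¬ IsTypeIBlowup u T →
        ∃ lam0 : ℝ, lam0 < 1 ∧ ∃ R0 : ℝ, 0 < R0 ∧ ∃ θ : ℝ, θ < 1 ∧ ∀ κ : ℝ, 0 < κ → ∀ ε : ℝ, 0 < ε →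
          ∀ δ : ℝ, 0 < δ → ∃ M : ℝ, 0 < M ∧ ∃ E : Set ℝ,
            (∃ h0 : ℝ, 0 < h0 ∧ ∀ h : ℝ, 0 < h → h < h0 →
              volume (E ∩ Set.Ioo (T - h) T) ≤ ENNReal.ofReal (θ * h)) ∧
            ∀ t ∈ Set.Ico 0 T, t ∉ E → ∀ x : EuclideanSpace ℝ (Fin 3), M ≤ ‖curl (u t) x‖ →
              κ / (T - t) ≤ ‖curl (u t) x‖ →
              volume {y : EuclideanSpace ℝ (Fin 3) | lam0 * ‖curl (u t) x‖ ≤ ‖curl (u t) y‖ ∧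
                  ‖x - y‖ ≤ R0 * Real.sqrt (ν / ‖curl (u t) x‖) ∧
                  ε < Real.sqrt (1 - (inner ℝ (‖curl (u t) x‖⁻¹ • curl (u t) x)
                    (‖curl (u t) y‖⁻¹ • curl (u t) y)) ^ 2)}
                ≤ ENNReal.ofReal (δ * Real.sqrt (ν / ‖curl (u t) x‖) ^ 3)) :
    ∀ (ν T : ℝ), 0 < ν → 0 < T → ∀ (u : ℝ → EuclideanSpace ℝ (Fin 3) → EuclideanSpace ℝ (Fin 3))
      (p : ℝ → EuclideanSpace ℝ (Fin 3) → ℝ), IsClassicalNSSolutionOn (Set.Ico 0 T) ν 0 u p →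
      IsLerayHopfOn T ν 0 (u 0) u → HasRapidSpatialDecay (u 0) →
      ∃ lam0 : ℝ, lam0 < 1 ∧ ∃ R0 : ℝ, 0 < R0 ∧ ∃ θ : ℝ, θ < 1 ∧ ∀ κ : ℝ, 0 < κ → ∀ q : ℝ, 0 < q →
        ∀ ε : ℝ, 0 < ε → ∀ δ : ℝ, 0 < δ → ∃ M : ℝ, 0 < M ∧ ∃ E : Set ℝ,
        (∃ h0 : ℝ, 0 < h0 ∧ ∀ h : ℝ, 0 < h → h < h0 →
          MeasureTheory.volume (E ∩ Set.Ioo (T - h) T) ≤ ENNReal.ofReal (θ * h)) ∧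
        ∀ t ∈ Set.Ico 0 T, t ∉ E → ∀ x : EuclideanSpace ℝ (Fin 3), M ≤ ‖curl (u t) x‖ →
        κ / (T - t) ≤ ‖curl (u t) x‖ → (∀ x' : EuclideanSpace ℝ (Fin 3), q * ‖curl (u t) x'‖ ≤ ‖curl (u t) x‖) →
          MeasureTheory.volume {y : EuclideanSpace ℝ (Fin 3) | lam0 * ‖curl (u t) x‖ ≤ ‖curl (u t) y‖ ∧
              ‖x - y‖ ≤ R0 * Real.sqrt (ν / ‖curl (u t) x‖) ∧
              ε < Real.sqrt (1 - (inner ℝ (‖curl (u t) x‖⁻¹ • curl (u t) x)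
                (‖curl (u t) y‖⁻¹ • curl (u t) y)) ^ 2)}
            ≤ ENNReal.ofReal (δ * Real.sqrt (ν / ‖curl (u t) x‖) ^ 3) :=
  nearMaxMostTimesBulkAlignment_of_aprioriMostTimesBulkAlignment
    (aprioriMostTimesBulkAlignment_of_universalSomeGoodWindowLaw_of_typeIIResidue hL hRII)

/-- **UDW∃ ∧ NoTypeII ⇒ Clay (A)** (`navierStokesRegularity_of_target_of_typeIliouvilleNoTypeII`; the residual in the
route's spelling `Theses.ScaledTopAlignment.NoTypeII`). [folklore] -/
theorem navierStokesRegularity_of_universalSomeGoodWindowLaw_of_noTypeII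
    (hL : ∃ lam0 : ℝ, lam0 < 1 ∧ ∃ R0 : ℝ, 0 < R0 ∧ ∃ θ : ℝ, θ < 1 ∧
      ∀ q : ℝ, 0 < q → ∀ δ : ℝ, 0 < δ → ∃ A : ℝ, 0 < A ∧
        ∀ (ν T : ℝ), 0 < ν → 0 < T → ∀ (u : ℝ → EuclideanSpace ℝ (Fin 3) → EuclideanSpace ℝ (Fin 3))
          (p : ℝ → EuclideanSpace ℝ (Fin 3) → ℝ),
          IsClassicalNSSolutionOn (Set.Ico 0 T) ν 0 u p → IsLerayHopfOn T ν 0 (u 0) u → HasRapidSpatialDecay (u 0) →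
          ∀ m0 : ℝ, 0 < m0 → (∀ x, ‖curl (u 0) x‖ ≤ m0) →
            ∃ E : Set ℝ, (∃ h0 : ℝ, 0 < h0 ∧ ∀ h : ℝ, 0 < h → h < h0 →
                volume (E ∩ Set.Ioo (T - h) T) ≤ ENNReal.ofReal (θ * h)) ∧
              ∀ t ∈ Set.Ico 0 T, t ∉ E →
                (∃ x : EuclideanSpace ℝ (Fin 3), A * m0 ≤ ‖curl (u t) x‖ ∧
                  ∀ x' : EuclideanSpace ℝ (Fin 3), q * ‖curl (u t) x'‖ ≤ ‖curl (u t) x‖) →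
                ∃ x : EuclideanSpace ℝ (Fin 3), A * m0 ≤ ‖curl (u t) x‖ ∧
                  (∀ x' : EuclideanSpace ℝ (Fin 3), q * ‖curl (u t) x'‖ ≤ ‖curl (u t) x‖) ∧
                  (∫⁻ y in {y : EuclideanSpace ℝ (Fin 3) | lam0 * ‖curl (u t) x‖ ≤ ‖curl (u t) y‖ ∧
                      ‖y - x‖ ≤ R0 * Real.sqrt (ν / ‖curl (u t) x‖)},
                    ENNReal.ofReal (‖curl (u t) y‖ ^ (3 / 2 : ℝ) *
                      ‖fderiv ℝ (vorticityDirection (curl (u t))) y‖ ^ 2)) ≤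
                  ENNReal.ofReal δ *
                    ∫⁻ y in {y : EuclideanSpace ℝ (Fin 3) | lam0 * ‖curl (u t) x‖ ≤ ‖curl (u t) y‖ ∧
                        ‖y - x‖ ≤ R0 * Real.sqrt (ν / ‖curl (u t) x‖)},
                      ENNReal.ofReal (‖curl (u t) y‖ ^ (5 / 2 : ℝ) / ν))
    (hII : Summit.NavierStokesRegularity.NavierStokesRegularity.Theses.ScaledTopAlignment.NoTypeII) :
    NavierStokesRegularity :=
  navierStokesRegularity_of_target_of_typeIliouvilleNoTypeII
    (threadingFluxTarget_of_universalSomeGoodWindowLaw hL) hII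

end Summit.NavierStokesRegularity.NavierStokesRegularity.Theorems

end
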